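import Mathlib

/-!
# `MatrixDescartes` census — DOOR A, the INTERIOR-DEFINITE-LETTER programme at its first format `(2,3)`:
# the FUTURE-TYPE LAW for a positive definite middle letter (at most TWO positive det-roots of positive type)

HONEST FRAMING.  Object-search cell `pub-symmetroid`, door-A seat `val-sym-door-p4` (gen 15); items
stmt-ValiantsHypothesis-19979 `DoorA26` / 19980 `DoorA34` (OPEN, typed, never asserted); helper file `--supports 19979`,
NO closure claim.  Nothing here bounds `ζ_sym(2,6)`, decides `DoorA26`/`DoorA34`, or bears on `MatrixDescartes`
(stmt-ValiantsHypothesis-18050) / `VP ≠ VNP`.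

CONTEXT (the cell's conjecture C-g3-2, `HOME/CONJECTURE.md` §2.1d; memo `IDL-doorp4g15.md` of this seat).  The
INTERIOR-DEFINITE-LETTER LAW «a Descartes-sharp symmetric `(2,K)` row has every interior letter indefinite» would, with the
parity law (`Census.pow_rank_mul_coeff_mul_coeff_pos_of_sharp`), give `DoorA26` on every MIXED chamber of the `2 608`-chamber
census at once (the hard chamber 1709 of the tall flag `(0,2,3,9,100,400)` among them).  Its first format is `(2,3)`: a real
symmetric pencil `S₀ + x^d·S₁ + x^e·S₂` (`0 < d < e`) with `S₁ ≻ 0` has at most `4 = D(2,3) − 1` positive det-roots (theory g3,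
THEOREM L5(iii), paper, by rigidity).  After the congruence `S₁ ↦ 1` the determinant factors over the reals as
`det F = (A − R)(A + R)`, `A = tr F / 2 = x^d + t₀ + t₂x^e`, `R = ‖p + x^e q‖` (`p, q ∈ ℂ ≅ ℝ²` the trace-free parts of
`S₀, S₂`; the identity letter contributes nothing to them), and a positive det-root `r` is of POSITIVE TYPE (`F(r) ⪰ 0`,
equivalently `tr F(r) ≥ 0`) iff `A(r) = R(r)`.  In the variable `y = x^e` the function `A − R = y^{d/e} + t₀ + t₂y − ‖p + yq‖`
is STRICTLY CONCAVE on `(0, ∞)` (`y^{d/e}` strictly concave, the norm of an affine function convex), hence vanishes at most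
twice.  This file proves exactly that:

* `strictConcaveOn_model` — strict concavity of `y ↦ y^a + t₀ + t₂·y − ‖p + y·q‖` on `(0,∞)` for `0 < a < 1`;
* `model_three_zeros` — such a function does not vanish at three points `0 < y₁ < y₂ < y₃`;
* `det_eq_halfTrace_sq_sub_normSq`, `model_eq_zero_of_root` — the pencil algebra (`det F = A² − ‖Z‖²`; a positive-type
  det-root is a zero of the model function at `y = x^e`);
* **`futureType_three_roots` (THE FUTURE-TYPE LAW, identity gauge)** — for real symmetric `S₀, S₂` and `0 < d < e` the
  pencil `F(x) = S₀ + x^d·1 + x^e·S₂` has no three positive det-roots `x₁ < x₂ < x₃` of positive type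
  (`det F(xᵢ) = 0`, `0 ≤ tr F(xᵢ)`); `card_futureType_le_two` — finset form: at most two.
  (Mirror: applied to `−F`, a pencil with middle letter `−1` has at most two positive det-roots of NEGATIVE type.)

What is NOT here: the past-type half at `(2,3)` (at most three zeros of `A + R`, via the sign changes of
`(A + R)'' = Δ²/R³ − a(1−a)y^{a−2}`, and the joint exclusion through the one-nappe/lens budget — memo §3), the general
positive definite middle letter (congruence to the identity gauge), and anything at `K ≥ 4`.

[folklore] Strict concavity of `y ↦ y^a` (`0 < a < 1`, Mathlib `Real.strictConcaveOn_rpow`), convexity of the norm; elementary.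
Axioms standard; no definitions.
-/

-- the D-0017 layout repeats a namespace component (single-conjunct summit); the `dupNamespace` linter flags it; name mandated.
set_option linter.dupNamespace false

namespace Summit.ValiantsHypothesis.ValiantsHypothesis.Theorems.LacunarySymmetroidMatrixDescartes.Census.DefiniteMiddle

open Real Matrix Finset
open scoped BigOperators

/-! ## §1 The model function `y ↦ y^a + t₀ + t₂·y − ‖p + y·q‖` is strictly concave on `(0,∞)` -/

/-- Concavity of `y ↦ −‖p + y·q‖` (`p, q ∈ ℂ`) on `(0,∞)`: the norm of an affine function is convex. [folklore] -/
theorem concaveOn_neg_norm_affine (p q : ℂ) :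
    ConcaveOn ℝ (Set.Ioi (0:ℝ)) (fun y : ℝ => -‖p + (y : ℂ) * q‖) := by
  refine ⟨convex_Ioi 0, ?_⟩
  intro x _ y _ a b ha hb hab
  have hsplit : p + (((a * x + b * y : ℝ)) : ℂ) * q
      = (a : ℂ) * (p + (x : ℂ) * q) + (b : ℂ) * (p + (y : ℂ) * q) := by
    have habC : ((a : ℂ)) + (b : ℂ) = 1 := by exact_mod_cast hab
    push_cast
    linear_combination (-(p : ℂ)) * habC
  have htri : ‖p + (((a * x + b * y : ℝ)) : ℂ) * q‖ ≤ a * ‖p + (x : ℂ) * q‖ + b * ‖p + (y : ℂ) * q‖ := by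
    rw [hsplit]
    refine (norm_add_le _ _).trans (le_of_eq ?_)
    rw [norm_mul, norm_mul, Complex.norm_real, Complex.norm_real, Real.norm_of_nonneg ha, Real.norm_of_nonneg hb]
  simp only [smul_eq_mul]
  linarith

/-- Concavity (indeed affinity) of `y ↦ t₀ + t₂·y` on `(0,∞)`. [folklore] -/
theorem concaveOn_affine (t₀ t₂ : ℝ) : ConcaveOn ℝ (Set.Ioi (0:ℝ)) (fun y : ℝ => t₀ + t₂ * y) := by
  refine ⟨convex_Ioi 0, ?_⟩
  intro x _ y _ a b _ _ hab
  simp only [smul_eq_mul]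
  have : a * (t₀ + t₂ * x) + b * (t₀ + t₂ * y) = t₀ + t₂ * (a * x + b * y) := by
    linear_combination t₀ * hab
  rw [this]

/-- **Strict concavity of the model function** `y ↦ y^a + t₀ + t₂·y − ‖p + y·q‖` on `(0,∞)` for `0 < a < 1`. [folklore] -/
theorem strictConcaveOn_model {a : ℝ} (ha0 : 0 < a) (ha1 : a < 1) (t₀ t₂ : ℝ) (p q : ℂ) :
    StrictConcaveOn ℝ (Set.Ioi (0:ℝ)) (fun y : ℝ => y ^ a + t₀ + t₂ * y - ‖p + (y : ℂ) * q‖) := by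
  have h1 : StrictConcaveOn ℝ (Set.Ioi (0:ℝ)) (fun y : ℝ => y ^ a) :=
    (Real.strictConcaveOn_rpow ha0 ha1).subset Set.Ioi_subset_Ici_self (convex_Ioi 0)
  have h2 := (h1.add_concaveOn (concaveOn_affine t₀ t₂)).add_concaveOn (concaveOn_neg_norm_affine p q)
  have hfun : (fun y : ℝ => y ^ a + t₀ + t₂ * y - ‖p + (y : ℂ) * q‖)
      = ((fun y : ℝ => y ^ a) + fun y : ℝ => t₀ + t₂ * y) + fun y : ℝ => -‖p + (y : ℂ) * q‖ := by
    funext y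
    simp only [Pi.add_apply]
    ring
  rw [hfun]
  exact h2

/-- **A strictly concave function on `(0,∞)` does not vanish at three points** `0 < y₁ < y₂ < y₃`. [folklore] -/
theorem three_zeros_of_strictConcaveOn {f : ℝ → ℝ} (hf : StrictConcaveOn ℝ (Set.Ioi (0:ℝ)) f)
    {y₁ y₂ y₃ : ℝ} (h0 : 0 < y₁) (h12 : y₁ < y₂) (h23 : y₂ < y₃)
    (hz1 : f y₁ = 0) (hz2 : f y₂ = 0) (hz3 : f y₃ = 0) : False := by
  have h13 : 0 < y₃ - y₁ := by linarith
  set μ : ℝ := (y₂ - y₁) / (y₃ - y₁) with hμ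
  set lam : ℝ := (y₃ - y₂) / (y₃ - y₁) with hlam
  have hlam0 : 0 < lam := div_pos (by linarith) h13
  have hμ0 : 0 < μ := div_pos (by linarith) h13
  have hsum : lam + μ = 1 := by
    rw [hlam, hμ, ← add_div, div_eq_one_iff_eq h13.ne']; ring
  have hcomb : lam • y₁ + μ • y₃ = y₂ := by
    simp only [smul_eq_mul, hlam, hμ]
    field_simp
    ring
  have hlt := hf.2 (show y₁ ∈ Set.Ioi (0:ℝ) from h0) (show y₃ ∈ Set.Ioi (0:ℝ) by
    simp only [Set.mem_Ioi]; linarith) (by linarith : y₁ ≠ y₃) hlam0 hμ0 hsum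
  rw [hcomb, hz1, hz2, hz3, smul_zero, smul_zero, add_zero] at hlt
  exact lt_irrefl _ hlt

/-- The model function does not vanish at three points `0 < y₁ < y₂ < y₃` (`0 < a < 1`). [folklore] -/
theorem model_three_zeros {a : ℝ} (ha0 : 0 < a) (ha1 : a < 1) (t₀ t₂ : ℝ) (p q : ℂ)
    {y₁ y₂ y₃ : ℝ} (h0 : 0 < y₁) (h12 : y₁ < y₂) (h23 : y₂ < y₃)
    (hz1 : y₁ ^ a + t₀ + t₂ * y₁ - ‖p + (y₁ : ℂ) * q‖ = 0)
    (hz2 : y₂ ^ a + t₀ + t₂ * y₂ - ‖p + (y₂ : ℂ) * q‖ = 0)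
    (hz3 : y₃ ^ a + t₀ + t₂ * y₃ - ‖p + (y₃ : ℂ) * q‖ = 0) : False :=
  three_zeros_of_strictConcaveOn (strictConcaveOn_model ha0 ha1 t₀ t₂ p q) h0 h12 h23 hz1 hz2 hz3

/-! ## §2 Pencil algebra: `det F = A² − ‖Z‖²` in the identity gauge -/

/-- Entries of the pencil `F(x) = S₀ + x^d·1 + x^e·S₂` in the identity gauge. [folklore] -/
theorem pencil_apply (S₀ S₂ : Matrix (Fin 2) (Fin 2) ℝ) (d e : ℕ) (x : ℝ) (i j : Fin 2) :
    (S₀ + x ^ d • (1 : Matrix (Fin 2) (Fin 2) ℝ) + x ^ e • S₂) i j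
      = S₀ i j + (if i = j then x ^ d else 0) + x ^ e * S₂ i j := by
  simp only [Matrix.add_apply, Matrix.smul_apply, Matrix.one_apply, smul_eq_mul, mul_ite, mul_one, mul_zero]

/-- **`det F = A² − ‖Z‖²`** for `F(x) = S₀ + x^d·1 + x^e·S₂` with `S₀, S₂` symmetric, where `A = tr F(x)/2 =
x^d + t₀ + t₂x^e` and `Z = p + x^e q ∈ ℂ` collects the trace-free parts (`re Z = F₀₁`, `im Z = (F₀₀ − F₁₁)/2`);
`(Sym₂(ℝ), det) ≅ ℝ^{1,2}` with the identity letter on the time axis. [folklore] -/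
theorem det_eq_halfTrace_sq_sub_normSq (S₀ S₂ : Matrix (Fin 2) (Fin 2) ℝ) (hS₀ : S₀.IsSymm) (hS₂ : S₂.IsSymm)
    (d e : ℕ) (x : ℝ) :
    (S₀ + x ^ d • (1 : Matrix (Fin 2) (Fin 2) ℝ) + x ^ e • S₂).det
      = (x ^ d + (S₀ 0 0 + S₀ 1 1) / 2 + (S₂ 0 0 + S₂ 1 1) / 2 * x ^ e) ^ 2
        - ‖((S₀ 0 1 : ℝ) : ℂ) + ((S₀ 0 0 - S₀ 1 1) / 2 : ℝ) * Complex.I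
            + (x ^ e : ℝ) * (((S₂ 0 1 : ℝ) : ℂ) + ((S₂ 0 0 - S₂ 1 1) / 2 : ℝ) * Complex.I)‖ ^ 2 := by
  have h10 : S₀ 1 0 = S₀ 0 1 := hS₀.apply 0 1
  have h10' : S₂ 1 0 = S₂ 0 1 := hS₂.apply 0 1
  rw [Complex.sq_norm, Complex.normSq_apply, Matrix.det_fin_two]
  simp only [pencil_apply, Fin.isValue, ↓reduceIte, one_ne_zero, zero_ne_one, add_zero, h10, h10',
    Complex.add_re, Complex.add_im, Complex.mul_re, Complex.mul_im, Complex.ofReal_re, Complex.ofReal_im,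
    Complex.I_re, Complex.I_im, mul_zero, mul_one, zero_mul, sub_zero, add_zero, zero_add]
  ring

/-- The half trace of the pencil in the identity gauge. [folklore] -/
theorem halfTrace_eq (S₀ S₂ : Matrix (Fin 2) (Fin 2) ℝ) (d e : ℕ) (x : ℝ) :
    (S₀ + x ^ d • (1 : Matrix (Fin 2) (Fin 2) ℝ) + x ^ e • S₂).trace / 2
      = x ^ d + (S₀ 0 0 + S₀ 1 1) / 2 + (S₂ 0 0 + S₂ 1 1) / 2 * x ^ e := by
  rw [Matrix.trace_fin_two, pencil_apply, pencil_apply]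
  simp only [Fin.isValue, ↓reduceIte]
  ring

/-- **A positive-type det-root is a zero of the model function at `y = x^e`.**  If `x > 0`, `det F(x) = 0` and
`tr F(x) ≥ 0` then `y^{d/e} + t₀ + t₂y − ‖p + yq‖ = 0` at `y = x^e` (`0 < e`). [folklore] -/
theorem model_eq_zero_of_root (S₀ S₂ : Matrix (Fin 2) (Fin 2) ℝ) (hS₀ : S₀.IsSymm) (hS₂ : S₂.IsSymm)
    {d e : ℕ} (he : 0 < e) {x : ℝ} (hx : 0 < x)
    (hdet : (S₀ + x ^ d • (1 : Matrix (Fin 2) (Fin 2) ℝ) + x ^ e • S₂).det = 0)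
    (htr : 0 ≤ (S₀ + x ^ d • (1 : Matrix (Fin 2) (Fin 2) ℝ) + x ^ e • S₂).trace) :
    (x ^ e) ^ ((d : ℝ) / e) + (S₀ 0 0 + S₀ 1 1) / 2 + (S₂ 0 0 + S₂ 1 1) / 2 * x ^ e
      - ‖(((S₀ 0 1 : ℝ) : ℂ) + ((S₀ 0 0 - S₀ 1 1) / 2 : ℝ) * Complex.I)
          + ((x ^ e : ℝ) : ℂ) * (((S₂ 0 1 : ℝ) : ℂ) + ((S₂ 0 0 - S₂ 1 1) / 2 : ℝ) * Complex.I)‖ = 0 := by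
  -- `(x^e)^{d/e} = x^d`
  have hpow : (x ^ e) ^ ((d : ℝ) / e) = x ^ d := by
    rw [← Real.rpow_natCast x e, ← Real.rpow_mul hx.le, ← Real.rpow_natCast x d]
    congr 1
    have : (e : ℝ) ≠ 0 := by exact_mod_cast he.ne'
    field_simp
  rw [hpow]
  set A : ℝ := x ^ d + (S₀ 0 0 + S₀ 1 1) / 2 + (S₂ 0 0 + S₂ 1 1) / 2 * x ^ e with hA
  set Z : ℂ := (((S₀ 0 1 : ℝ) : ℂ) + ((S₀ 0 0 - S₀ 1 1) / 2 : ℝ) * Complex.I)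
          + ((x ^ e : ℝ) : ℂ) * (((S₂ 0 1 : ℝ) : ℂ) + ((S₂ 0 0 - S₂ 1 1) / 2 : ℝ) * Complex.I) with hZ
  have hA0 : 0 ≤ A := by
    have := halfTrace_eq S₀ S₂ d e x
    rw [hA]; linarith
  have hsq : A ^ 2 - ‖Z‖ ^ 2 = 0 := by
    rw [hA, hZ, ← det_eq_halfTrace_sq_sub_normSq S₀ S₂ hS₀ hS₂ d e x]; exact hdet
  have hAZ : ‖Z‖ = A := by
    rw [← Real.sqrt_sq (norm_nonneg Z), ← Real.sqrt_sq hA0]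
    congr 1
    linarith
  linarith

/-! ## §3 The future-type law -/

/-- **THE FUTURE-TYPE LAW at `(2,3)`, identity gauge.**  For real symmetric `S₀, S₂` and exponents `0 < d < e` the pencil
`F(x) = S₀ + x^d·1 + x^e·S₂` does not have three positive det-roots `x₁ < x₂ < x₃` of positive type
(`det F(xᵢ) = 0` and `tr F(xᵢ) ≥ 0`, i.e. `F(xᵢ) ⪰ 0`): the positive-type roots are zeros of the strictly concave
function `y^{d/e} + t₀ + t₂y − ‖p + yq‖` at `y = x^e`. [folklore] -/
theorem futureType_three_roots (S₀ S₂ : Matrix (Fin 2) (Fin 2) ℝ) (hS₀ : S₀.IsSymm) (hS₂ : S₂.IsSymm)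
    {d e : ℕ} (hd : 0 < d) (hde : d < e) {x₁ x₂ x₃ : ℝ} (h0 : 0 < x₁) (h12 : x₁ < x₂) (h23 : x₂ < x₃)
    (hdet : ∀ x ∈ [x₁, x₂, x₃], (S₀ + x ^ d • (1 : Matrix (Fin 2) (Fin 2) ℝ) + x ^ e • S₂).det = 0)
    (htr : ∀ x ∈ [x₁, x₂, x₃], 0 ≤ (S₀ + x ^ d • (1 : Matrix (Fin 2) (Fin 2) ℝ) + x ^ e • S₂).trace) : False := by
  have he : 0 < e := lt_trans hd hde
  have ha0 : 0 < (d : ℝ) / e := div_pos (by exact_mod_cast hd) (by exact_mod_cast he)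
  have ha1 : (d : ℝ) / e < 1 := (div_lt_one (by exact_mod_cast he)).mpr (by exact_mod_cast hde)
  have hx₂ : 0 < x₂ := lt_trans h0 h12
  have hx₃ : 0 < x₃ := lt_trans hx₂ h23
  have hy0 : 0 < x₁ ^ e := pow_pos h0 e
  have hy12 : x₁ ^ e < x₂ ^ e := pow_lt_pow_left₀ h12 h0.le he.ne'
  have hy23 : x₂ ^ e < x₃ ^ e := pow_lt_pow_left₀ h23 hx₂.le he.ne'
  have hz1 := model_eq_zero_of_root S₀ S₂ hS₀ hS₂ he h0 (hdet x₁ (by simp)) (htr x₁ (by simp))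
  have hz2 := model_eq_zero_of_root S₀ S₂ hS₀ hS₂ he hx₂ (hdet x₂ (by simp)) (htr x₂ (by simp))
  have hz3 := model_eq_zero_of_root S₀ S₂ hS₀ hS₂ he hx₃ (hdet x₃ (by simp)) (htr x₃ (by simp))
  exact model_three_zeros ha0 ha1 _ _ _ _ hy0 hy12 hy23 hz1 hz2 hz3

/-- **Finset form: at most TWO positive det-roots of positive type** for `F(x) = S₀ + x^d·1 + x^e·S₂`
(`S₀, S₂` real symmetric, `0 < d < e`): every finite set of positive reals at which `det F = 0` and `tr F ≥ 0` has at
most two elements. [folklore] -/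
theorem card_futureType_le_two (S₀ S₂ : Matrix (Fin 2) (Fin 2) ℝ) (hS₀ : S₀.IsSymm) (hS₂ : S₂.IsSymm)
    {d e : ℕ} (hd : 0 < d) (hde : d < e) (T : Finset ℝ)
    (hT : ∀ x ∈ T, 0 < x ∧ (S₀ + x ^ d • (1 : Matrix (Fin 2) (Fin 2) ℝ) + x ^ e • S₂).det = 0 ∧
      0 ≤ (S₀ + x ^ d • (1 : Matrix (Fin 2) (Fin 2) ℝ) + x ^ e • S₂).trace) :
    T.card ≤ 2 := by
  by_contra hlt
  have h3 : 3 ≤ T.card := by omega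
  set r := T.orderEmbOfFin rfl with hr
  have hmem : ∀ i, r i ∈ T := fun i => Finset.orderEmbOfFin_mem T rfl i
  let i₁ : Fin T.card := ⟨0, by omega⟩
  let i₂ : Fin T.card := ⟨1, by omega⟩
  let i₃ : Fin T.card := ⟨2, by omega⟩
  have h12 : r i₁ < r i₂ := r.strictMono (Fin.mk_lt_mk.mpr (by norm_num))
  have h23 : r i₂ < r i₃ := r.strictMono (Fin.mk_lt_mk.mpr (by norm_num))
  refine futureType_three_roots S₀ S₂ hS₀ hS₂ hd hde (hT _ (hmem i₁)).1 h12 h23 ?_ ?_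
  · intro x hx
    simp only [List.mem_cons, List.not_mem_nil, or_false] at hx
    rcases hx with rfl | rfl | rfl <;> exact (hT _ (hmem _)).2.1
  · intro x hx
    simp only [List.mem_cons, List.not_mem_nil, or_false] at hx
    rcases hx with rfl | rfl | rfl <;> exact (hT _ (hmem _)).2.2

end Summit.ValiantsHypothesis.ValiantsHypothesis.Theorems.LacunarySymmetroidMatrixDescartes.Census.DefiniteMiddle
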